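import Summits.Ventures.HSemireg.WedgeHankelRecurrenceCensusPolar

/-!
# Venture HSemireg — THE CENSUS BY (MIDDLE RANK, DEGREE OF THE MINIMAL RECURRENCE): for `2r ≤ N + 1` the `(s² − 1)·s^{2r−2}` classes on `[0, N]` of middle rank `r ≥ 1` split by the
# degree `d ≤ r` of their minimal recurrence as **`(s − 1)·s^{2r−1}` (`d = r`, affine) + `Σ_{1 ≤ d < r} (s − 1)s^{2d−1}·(s − 1)s^{r−d−1}` + `(s − 1)·s^{r−1}` (`d = 0`, pure polar)**;
# in particular **`P_N(r) = Σ_{d < r} #{R = r, deg = d}`** (gen-28 OPEN (a): N51's counts partition N44's polar census)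

HONEST FRAMING. Part of the Lean index of the computation cell `pub-hsemireg` (seat p10 gen 29, Sunday typer «UNIFORM-IN-n»).
LINEAR ALGEBRA OF HANKEL (catalecticant) MATRICES and of polynomials over a field ONLY: no variety, no cohomology theory, no sheaf, no Ext group and no semiregularity map is constructed
here; nothing here says that HC / HC_CM / HC_AV holds; no Literature fact is declared or used.  Custodian versions as in `WedgeHankelSiegelIdeal` (1/3); the dictionary («`d` = length of
the affine part of the apolar scheme, `r − d` = its multiplicity at `∞`», N34) is QUOTED, never asserted.

WHAT IS IN THE TREE.  N43 (`WedgeHankelRecurrenceClasses`, № 323): `IsAffineClass`, `IsPolarClass`, `isAffineClass_or_isPolarClass`, `IsAffineClass.not_isPolarClass`, `IsPolarClass.exists_mem`,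
`natDegree_eq_of_mem_recSpace_self`; N44 (№ 326): `seqOf`, `ncard_setOf_isAffineClass` (`(s−1)s^{2r−1}`), `ncard_setOf_isAffineClass_zero`, `ncard_setOf_isPolarClass` (`(s−1)s^{2r−2}`),
`ncard_setOf_rank_half_eq_add`; N51 (№ 340): `ncard_setOf_isPolarClass_of_natDegree_eq'` / `_eq_zero`; N18 (№ 173) `natDegree_le_of_mem_recSpace`; N23 `recSpace_congr`.  Mathlib:
`Finset.card_eq_sum_card_fiberwise`, `Set.ncard_coe_finset`.
THIS FILE (namespace `Summit.Ventures.HSemireg.Wedge.HankelOuter` continued; PLAIN on tree files; 1 definition `recDegree`):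
* §577 `recDegree K N r q` (the degree of a non-zero element of `Rec^N_r(q)`, `0` if none) [definition of this file]; `recDegree_le` (`≤ r`), **`recDegree_eq_natDegree`** (`R^N(q) = r`,
  `2r ≤ N + 1`: every non-zero `m ∈ Rec^N_r(q)` has degree `recDegree`), `recDegree_congr`, **`isAffineClass_iff_recDegree_eq`**, **`isPolarClass_iff_recDegree_lt`**,
  `rank_eq_and_recDegree_eq_self_iff`, `rank_eq_and_recDegree_eq_iff_of_lt`, `not_rank_eq_and_recDegree_eq_of_lt`.
* §578 THE TABLE (`2r ≤ N + 1`, `s = #K`): **`ncard_setOf_rank_eq_and_recDegree_eq_self`** (`d = r ≥ 1`: `(s−1)s^{2r−1}`), `…_self_zero` (`r = 0`: `1`), **`…_of_lt`** (`1 ≤ d < r`: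
  `(s−1)s^{2d−1}·(s−1)s^{r−d−1}`), `…_zero_of_lt` (`d = 0 < r`: `(s−1)s^{r−1}`), `…_of_gt` (`d > r`: `0`).
* §579 THE PARTITIONS: **`sum_ncard_setOf_rank_eq_and_recDegree_eq`** (`Σ_{d ≤ r} #{R = r, recDegree = d} = T_N(r)`), **`sum_ncard_setOf_isPolarClass_and_recDegree_eq`**
  (`Σ_{d < r} #{polar, recDegree = d} = P_N(r)`), **`sum_ncard_setOf_isPolarClass_of_natDegree_eq`** (gen-28 OPEN (a) literally: `Σ_{d < r}` of N51's sets `= P_N(r)`), and the closed-form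
  identity **`sum_census_table_polar`** (`(s−1)s^{r−1} + Σ_{1 ≤ d < r} (s−1)s^{2d−1}(s−1)s^{r−d−1} = (s−1)s^{2r−2}` for `s = #K`, read off the two censuses — no arithmetic).
Nothing Ext-side.  New names only.
-/

open Module Polynomial
open scoped Matrix Polynomial

namespace Summit.Ventures.HSemireg.Wedge.HankelOuter

open Summit.Ventures.HSemireg.Wedge Summit.Ventures.HSemireg.Wedge.Hankel

variable (K : Type*) [Field K] {N : ℕ}

omit [Field K] in
/-- counting by a filter (utility, private). -/
private theorem ncard_setOf_eq_card_filter''' {α : Type*} [Fintype α] (P : α → Prop) [DecidablePred P] : {a | P a}.ncard = (Finset.univ.filter P).card := by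
  rw [← Finset.coe_filter_univ, Set.ncard_coe_finset]

/-! ## §577. The degree of the minimal recurrence -/

open Classical in
/-- THE DEGREE OF THE MINIMAL RECURRENCE IN WINDOW `r`: the degree of some non-zero element of `Rec^N_r(q)` (`0` if `Rec^N_r(q) = 0`); when `R^N(q) = r` and `2r ≤ N + 1` all non-zero
elements of the line `Rec^N_r(q)` have this degree (`recDegree_eq_natDegree`). [definition of this file] -/
noncomputable def recDegree (N r : ℕ) (q : ℕ → K) : ℕ :=
  if h : ∃ m : K[X], m ∈ recSpace K N q r ∧ m ≠ 0 then (Classical.choose h).natDegree else 0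

/-- `recDegree ≤ r` (recurrences in window `r` have degree `≤ r`). -/
theorem recDegree_le (N r : ℕ) (q : ℕ → K) : recDegree K N r q ≤ r := by
  unfold recDegree
  split_ifs with h
  · exact natDegree_le_of_mem_recSpace K (Classical.choose_spec h).1
  · exact Nat.zero_le _

/-- **for `R^N(q) = r`, `2r ≤ N + 1`: every non-zero `m ∈ Rec^N_r(q)` has degree `recDegree K N r q`** (the window is a line, N18/N43). -/
theorem recDegree_eq_natDegree {r : ℕ} {q : ℕ → K} (hq : (hankel1 K N (N / 2) q).rank = r) (h2 : r + r ≤ N + 1) {m : K[X]} (hm : m ∈ recSpace K N q r) (hm0 : m ≠ 0) :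
    recDegree K N r q = m.natDegree := by
  have h : ∃ m : K[X], m ∈ recSpace K N q r ∧ m ≠ 0 := ⟨m, hm, hm0⟩
  unfold recDegree
  rw [dif_pos h]
  exact natDegree_eq_of_mem_recSpace_self K hq h2 hm hm0 (Classical.choose_spec h).1 (Classical.choose_spec h).2

/-- classes agreeing on `[0, N]` have the same `recDegree`. -/
theorem recDegree_congr (r : ℕ) {q q' : ℕ → K} (h : ∀ j ≤ N, q j = q' j) : recDegree K N r q = recDegree K N r q' := by
  unfold recDegree
  rw [recSpace_congr K h r]

/-- **AFFINE ⟺ `recDegree = r`** (`R^N(q) = r`, `2r ≤ N + 1`). -/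
theorem isAffineClass_iff_recDegree_eq {r : ℕ} {q : ℕ → K} (hq : (hankel1 K N (N / 2) q).rank = r) (h2 : r + r ≤ N + 1) : IsAffineClass K N r q ↔ recDegree K N r q = r := by
  constructor
  · rintro ⟨-, m, hm, hm0, hmd⟩
    rw [recDegree_eq_natDegree K hq h2 hm hm0, hmd]
  · intro hd
    obtain ⟨m, hm0, hspan⟩ := exists_recSpace_self_eq_span K hq h2
    have hm : m ∈ recSpace K N q r := by rw [hspan]; exact Submodule.mem_span_singleton_self m
    exact ⟨hq, m, hm, hm0, by rw [← recDegree_eq_natDegree K hq h2 hm hm0, hd]⟩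

/-- **POLAR ⟺ `recDegree < r`** (`R^N(q) = r`, `2r ≤ N + 1`). -/
theorem isPolarClass_iff_recDegree_lt {r : ℕ} {q : ℕ → K} (hq : (hankel1 K N (N / 2) q).rank = r) (h2 : r + r ≤ N + 1) : IsPolarClass K N r q ↔ recDegree K N r q < r := by
  constructor
  · intro hP
    obtain ⟨m, d, e, hm, hm0, hmd, he, hde⟩ := hP.exists_mem h2
    rw [recDegree_eq_natDegree K hq h2 hm hm0, hmd]; omega
  · intro hd
    rcases isAffineClass_or_isPolarClass K hq with hA | hP
    · rw [(isAffineClass_iff_recDegree_eq K hq h2).mp hA] at hd; omega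
    · exact hP

/-- the fibre `d = r`: `R^N(q) = r ∧ recDegree = r ⟺ affine of rank r` (`2r ≤ N + 1`). -/
theorem rank_eq_and_recDegree_eq_self_iff {r : ℕ} (h2 : r + r ≤ N + 1) (q : ℕ → K) : (hankel1 K N (N / 2) q).rank = r ∧ recDegree K N r q = r ↔ IsAffineClass K N r q :=
  ⟨fun h => (isAffineClass_iff_recDegree_eq K h.1 h2).mpr h.2, fun h => ⟨h.rank_eq, (isAffineClass_iff_recDegree_eq K h.rank_eq h2).mp h⟩⟩

/-- the fibres `d < r`: `R^N(q) = r ∧ recDegree = d ⟺ polar of rank `r` with a non-zero recurrence of degree `d` in window `r` (N51's form; `2r ≤ N + 1`). -/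
theorem rank_eq_and_recDegree_eq_iff_of_lt {r d : ℕ} (hdr : d < r) (h2 : r + r ≤ N + 1) (q : ℕ → K) :
    (hankel1 K N (N / 2) q).rank = r ∧ recDegree K N r q = d ↔ IsPolarClass K N r q ∧ ∃ m ∈ recSpace K N q r, m ≠ 0 ∧ m.natDegree = d := by
  constructor
  · rintro ⟨hq, hd⟩
    have hP : IsPolarClass K N r q := (isPolarClass_iff_recDegree_lt K hq h2).mpr (by omega)
    obtain ⟨m, d', e, hm, hm0, hmd, -, -⟩ := hP.exists_mem h2
    exact ⟨hP, m, hm, hm0, by rw [← recDegree_eq_natDegree K hq h2 hm hm0, hd]⟩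
  · rintro ⟨hP, m, hm, hm0, hmd⟩
    exact ⟨hP.rank_eq, by rw [recDegree_eq_natDegree K hP.rank_eq h2 hm hm0, hmd]⟩

/-- the fibres `d > r` are empty. -/
theorem not_rank_eq_and_recDegree_eq_of_lt {r d : ℕ} (hrd : r < d) (q : ℕ → K) : ¬ ((hankel1 K N (N / 2) q).rank = r ∧ recDegree K N r q = d) := by
  rintro ⟨-, hd⟩
  have := recDegree_le K N r q
  omega

/-! ## §578. The table: classes on `[0, N]` by (middle rank `r`, degree `d` of the minimal recurrence), `2r ≤ N + 1` -/

/-- **`d = r ≥ 1` (affine): `(s − 1)·s^{2r−1}` classes.** -/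
theorem ncard_setOf_rank_eq_and_recDegree_eq_self [Finite K] {r : ℕ} (hr : 1 ≤ r) (h2 : r + r ≤ N + 1) :
    {v : Fin (N + 1) → K | (hankel1 K N (N / 2) (seqOf K v)).rank = r ∧ recDegree K N r (seqOf K v) = r}.ncard = (Nat.card K - 1) * Nat.card K ^ (2 * r - 1) := by
  rw [← ncard_setOf_isAffineClass K hr h2]
  exact congrArg Set.ncard (Set.ext fun v => rank_eq_and_recDegree_eq_self_iff K h2 _)

/-- `d = r = 0`: the zero class only. -/
theorem ncard_setOf_rank_eq_and_recDegree_eq_self_zero (N : ℕ) :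
    {v : Fin (N + 1) → K | (hankel1 K N (N / 2) (seqOf K v)).rank = 0 ∧ recDegree K N 0 (seqOf K v) = 0}.ncard = 1 := by
  have hset : {v : Fin (N + 1) → K | (hankel1 K N (N / 2) (seqOf K v)).rank = 0 ∧ recDegree K N 0 (seqOf K v) = 0} = {v : Fin (N + 1) → K | IsAffineClass K N 0 (seqOf K v)} :=
    Set.ext fun v => rank_eq_and_recDegree_eq_self_iff K (by omega) _
  rw [hset, ncard_setOf_isAffineClass_zero]

/-- **`1 ≤ d < r`: `(s − 1)s^{2d−1} · (s − 1)s^{r−d−1}` classes** (a reduced symbol of degree `d` plus a polar part of exact order `r − d`, N51). -/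
theorem ncard_setOf_rank_eq_and_recDegree_eq_of_lt [Finite K] {r d : ℕ} (hd : 1 ≤ d) (hdr : d < r) (h2 : r + r ≤ N + 1) :
    {v : Fin (N + 1) → K | (hankel1 K N (N / 2) (seqOf K v)).rank = r ∧ recDegree K N r (seqOf K v) = d}.ncard
      = ((Nat.card K - 1) * Nat.card K ^ (2 * d - 1)) * ((Nat.card K - 1) * Nat.card K ^ (r - d - 1)) := by
  obtain ⟨e, rfl⟩ := Nat.exists_eq_add_of_lt hdr
  have h := ncard_setOf_isPolarClass_of_natDegree_eq' K (N := N) (d := d) (e := e + 1) hd (by omega) (by omega)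
  rw [show d + e + 1 - d - 1 = e + 1 - 1 by omega, ← h]
  exact congrArg Set.ncard (Set.ext fun v => rank_eq_and_recDegree_eq_iff_of_lt K hdr h2 _)

/-- **`d = 0 < r` (pure polar): `(s − 1)·s^{r−1}` classes.** -/
theorem ncard_setOf_rank_eq_and_recDegree_eq_zero_of_lt [Finite K] {r : ℕ} (hr : 1 ≤ r) (h2 : r + r ≤ N + 1) :
    {v : Fin (N + 1) → K | (hankel1 K N (N / 2) (seqOf K v)).rank = r ∧ recDegree K N r (seqOf K v) = 0}.ncard = (Nat.card K - 1) * Nat.card K ^ (r - 1) := by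
  rw [← ncard_setOf_isPolarClass_of_natDegree_eq_zero K hr h2]
  exact congrArg Set.ncard (Set.ext fun v => rank_eq_and_recDegree_eq_iff_of_lt K (by omega) h2 _)

/-- `d > r`: no classes. -/
theorem ncard_setOf_rank_eq_and_recDegree_eq_of_gt {r d : ℕ} (hrd : r < d) :
    {v : Fin (N + 1) → K | (hankel1 K N (N / 2) (seqOf K v)).rank = r ∧ recDegree K N r (seqOf K v) = d}.ncard = 0 := by
  have hset : {v : Fin (N + 1) → K | (hankel1 K N (N / 2) (seqOf K v)).rank = r ∧ recDegree K N r (seqOf K v) = d} = (∅ : Set (Fin (N + 1) → K)) :=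
    Set.eq_empty_iff_forall_notMem.mpr fun v hv => not_rank_eq_and_recDegree_eq_of_lt K hrd _ hv
  exact (congrArg Set.ncard hset).trans (Set.ncard_empty _)

/-! ## §579. The partitions: summing the table over `d` -/

/-- **`Σ_{d ≤ r} #{v | R^N(v) = r, recDegree = d} = T_N(r) := #{v | R^N(v) = r}`** (the fibres of `recDegree` on the rank-`r` classes; any `N`, `r`). -/
theorem sum_ncard_setOf_rank_eq_and_recDegree_eq [Finite K] (N r : ℕ) :
    ∑ d ∈ Finset.range (r + 1), {v : Fin (N + 1) → K | (hankel1 K N (N / 2) (seqOf K v)).rank = r ∧ recDegree K N r (seqOf K v) = d}.ncard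
      = {v : Fin (N + 1) → K | (hankel1 K N (N / 2) (seqOf K v)).rank = r}.ncard := by
  classical
  haveI := Fintype.ofFinite K
  have hmaps : ((Finset.univ.filter fun v : Fin (N + 1) → K => (hankel1 K N (N / 2) (seqOf K v)).rank = r) : Set (Fin (N + 1) → K)).MapsTo
      (fun v => recDegree K N r (seqOf K v)) (Finset.range (r + 1) : Finset ℕ) := fun v _ =>
    Finset.mem_coe.mpr (Finset.mem_range.mpr (Nat.lt_succ_of_le (recDegree_le K N r _)))
  have h := Finset.card_eq_sum_card_fiberwise hmaps
  rw [ncard_setOf_eq_card_filter''', h]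
  refine Finset.sum_congr rfl fun d _ => ?_
  rw [ncard_setOf_eq_card_filter''', Finset.filter_filter]

/-- **`Σ_{d < r} #{v | polar of rank r, recDegree = d} = P_N(r)`** (any `N`, `r`: a polar class has `recDegree < r` as soon as its window is a line; in general we only use `recDegree ≤ r`
and that `recDegree = r` forces affine when `2r ≤ N + 1` — so this version carries `2r ≤ N + 1`). -/
theorem sum_ncard_setOf_isPolarClass_and_recDegree_eq [Finite K] {r : ℕ} (h2 : r + r ≤ N + 1) :
    ∑ d ∈ Finset.range r, {v : Fin (N + 1) → K | IsPolarClass K N r (seqOf K v) ∧ recDegree K N r (seqOf K v) = d}.ncard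
      = {v : Fin (N + 1) → K | IsPolarClass K N r (seqOf K v)}.ncard := by
  classical
  haveI := Fintype.ofFinite K
  have hmaps : ((Finset.univ.filter fun v : Fin (N + 1) → K => IsPolarClass K N r (seqOf K v)) : Set (Fin (N + 1) → K)).MapsTo
      (fun v => recDegree K N r (seqOf K v)) (Finset.range r : Finset ℕ) := fun v hv => by
    have hP : IsPolarClass K N r (seqOf K v) := (Finset.mem_filter.mp (Finset.mem_coe.mp hv)).2
    exact Finset.mem_coe.mpr (Finset.mem_range.mpr ((isPolarClass_iff_recDegree_lt K hP.rank_eq h2).mp hP))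
  have h := Finset.card_eq_sum_card_fiberwise hmaps
  rw [ncard_setOf_eq_card_filter''', h]
  refine Finset.sum_congr rfl fun d _ => ?_
  rw [ncard_setOf_eq_card_filter''', Finset.filter_filter]

/-- **GEN-28 OPEN (a): THE POLAR CENSUS IS PARTITIONED BY THE DEGREE OF THE MINIMAL RECURRENCE — `Σ_{d < r} #{v | polar of rank r with a non-zero recurrence of degree d in window r}
= P_N(r)`** (N51's sets, `2r ≤ N + 1`). -/
theorem sum_ncard_setOf_isPolarClass_of_natDegree_eq [Finite K] {r : ℕ} (h2 : r + r ≤ N + 1) :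
    ∑ d ∈ Finset.range r, {v : Fin (N + 1) → K | IsPolarClass K N r (seqOf K v) ∧ ∃ m ∈ recSpace K N (seqOf K v) r, m ≠ 0 ∧ m.natDegree = d}.ncard
      = {v : Fin (N + 1) → K | IsPolarClass K N r (seqOf K v)}.ncard := by
  rw [← sum_ncard_setOf_isPolarClass_and_recDegree_eq K h2]
  refine Finset.sum_congr rfl fun d hd => congrArg Set.ncard (Set.ext fun v => ?_)
  rw [Set.mem_setOf_eq, Set.mem_setOf_eq, ← rank_eq_and_recDegree_eq_iff_of_lt K (Finset.mem_range.mp hd) h2]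
  exact ⟨fun h => ⟨(isPolarClass_iff_recDegree_lt K h.1 h2).mpr (by rw [h.2]; exact Finset.mem_range.mp hd), h.2⟩, fun h => ⟨h.1.rank_eq, h.2⟩⟩

/-- **THE CLOSED FORMS ARE CONSISTENT: `(s − 1)s^{r−1} + Σ_{1 ≤ d < r} (s − 1)s^{2d−1}·(s − 1)s^{r−d−1} = (s − 1)s^{2r−2}`** for `s = #K`, `r ≥ 1` — the polar census (N44) read through
the table (§578); no arithmetic is performed. -/
theorem sum_census_table_polar [Finite K] {r : ℕ} (hr : 1 ≤ r) :
    ∑ d ∈ Finset.range r, (if d = 0 then (Nat.card K - 1) * Nat.card K ^ (r - 1) else ((Nat.card K - 1) * Nat.card K ^ (2 * d - 1)) * ((Nat.card K - 1) * Nat.card K ^ (r - d - 1)))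
      = (Nat.card K - 1) * Nat.card K ^ (2 * r - 2) := by
  have h2 : r + r ≤ (r + r - 1) + 1 := by omega
  rw [← ncard_setOf_isPolarClass K (N := r + r - 1) hr h2, ← sum_ncard_setOf_isPolarClass_and_recDegree_eq K h2]
  refine Finset.sum_congr rfl fun d hd => ?_
  have hdr := Finset.mem_range.mp hd
  have hset : {v : Fin (r + r - 1 + 1) → K | IsPolarClass K (r + r - 1) r (seqOf K v) ∧ recDegree K (r + r - 1) r (seqOf K v) = d}
      = {v : Fin (r + r - 1 + 1) → K | (hankel1 K (r + r - 1) ((r + r - 1) / 2) (seqOf K v)).rank = r ∧ recDegree K (r + r - 1) r (seqOf K v) = d} := Set.ext fun v =>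
    ⟨fun h => ⟨h.1.rank_eq, h.2⟩, fun h => ⟨(isPolarClass_iff_recDegree_lt K h.1 h2).mpr (by rw [h.2]; exact hdr), h.2⟩⟩
  rw [hset]
  split_ifs with hd0
  · rw [hd0, ncard_setOf_rank_eq_and_recDegree_eq_zero_of_lt K hr h2]
  · rw [ncard_setOf_rank_eq_and_recDegree_eq_of_lt K (by omega) hdr h2]

end Summit.Ventures.HSemireg.Wedge.HankelOuter
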